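import Literature.MathematicalPhysics.StatisticalMechanics.HardDiscStarSymmetry
import HarnessLib

/-!
# The complete-star Mayer diagram of hard discs, Ib: the six pieces exhaust the star

Companion of `HardDiscStarSymmetry.lean` (same sets `star`, `P₁, …, P₆`, written out): the set of
configurations on which two of the six squared distances among `0, x, y, z` coincide is
Lebesgue-null (each coincidence `d_i = d_j` is a monic quadratic equation in one of the
coordinates `x₁, y₁, z₁` given the other five, so its sections have at most two points; Tonelli),
off that set one squared distance is the strict maximum, and the pieces are pairwise disjoint.
With the equal-volume statements of part I this gives the symmetry reduction

  `volume_star_eq : vol(star) = 6 · vol(P₁)`.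

All auxiliary results are [folklore]; sub-namespace `HardDiscStarVolume`; no definitions, no named
facts.

## References

* [ClisbyMccoy2004] N. Clisby, B. M. McCoy, J. Stat. Phys. 114 (2004) 1343–1361, §§1–2.
-/

noncomputable section

open _root_.MeasureTheory _root_.Set _root_.Real intervalIntegral

namespace Literature.MathematicalPhysics.StatisticalMechanics

namespace HardDiscStarVolume

open HardDiscTriangleVolume HardDiscRingVolume

open scoped Pointwise

/-! ### Ties are null -/

/-- For every `t` the set of `s : ℝ` with `(s − a)² = b` has at most two points; hence a planar
set of this form in the first coordinate is Lebesgue-null (Tonelli). [folklore] -/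
theorem volume_quadSection_fst {g h : ℝ → ℝ} (hg : Measurable g) (hh : Measurable h) :
    volume {q : ℝ × ℝ | (q.1 - g q.2) ^ 2 = h q.2} = 0 := by
  have hS : MeasurableSet {q : ℝ × ℝ | (q.1 - g q.2) ^ 2 = h q.2} :=
    measurableSet_eq_fun (by fun_prop) (by fun_prop)
  have hsec : ∀ t : ℝ,
      volume ((fun s : ℝ => (s, t)) ⁻¹' {q : ℝ × ℝ | (q.1 - g q.2) ^ 2 = h q.2}) = 0 := by
    intro t
    refine measure_mono_null (t := {g t + √(h t), g t - √(h t)}) ?_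
      (((Set.finite_singleton _).insert _).measure_zero _)
    intro s hs
    simp only [mem_preimage, mem_setOf_eq] at hs
    have habs : |s - g t| = √(h t) := by rw [← Real.sqrt_sq_eq_abs, hs]
    simp only [mem_insert_iff, mem_singleton_iff]
    rcases (abs_eq (sqrt_nonneg _)).mp habs with h1 | h1
    · left; linarith
    · right; linarith
  rw [Measure.volume_eq_prod, Measure.prod_apply_symm hS]
  simp only [hsec, lintegral_zero]

/-- The same with an arbitrary block of further coordinates `R`: the set of configurations whose
first coordinate solves a monic quadratic equation in terms of the others is null. [folklore] -/
theorem volume_quadSection_prod {R : Type*} [MeasureSpace R] [SFinite (volume : Measure R)]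
    {g h : ℝ × R → ℝ} (hg : Measurable g) (hh : Measurable h) :
    volume {c : (ℝ × ℝ) × R | (c.1.1 - g (c.1.2, c.2)) ^ 2 = h (c.1.2, c.2)} = 0 := by
  have hS : MeasurableSet {c : (ℝ × ℝ) × R | (c.1.1 - g (c.1.2, c.2)) ^ 2 = h (c.1.2, c.2)} :=
    measurableSet_eq_fun (by fun_prop) (by fun_prop)
  have hsec : ∀ r : R, volume ((fun x : ℝ × ℝ => (x, r)) ⁻¹'
      {c : (ℝ × ℝ) × R | (c.1.1 - g (c.1.2, c.2)) ^ 2 = h (c.1.2, c.2)}) = 0 := by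
    intro r
    exact volume_quadSection_fst (g := fun t => g (t, r)) (h := fun t => h (t, r))
      (by fun_prop) (by fun_prop)
  rw [Measure.volume_eq_prod, Measure.prod_apply_symm hS]
  simp only [hsec, lintegral_zero]

/-- Ties decided in the coordinate `x₁`. [folklore] -/
theorem volume_tie_x {g h : ℝ × ((ℝ × ℝ) × (ℝ × ℝ)) → ℝ} (hg : Measurable g) (hh : Measurable h) :
    volume {c : ((ℝ × ℝ) × ((ℝ × ℝ) × (ℝ × ℝ))) |
      (c.1.1 - g (c.1.2, c.2)) ^ 2 = h (c.1.2, c.2)} = 0 :=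
  volume_quadSection_prod hg hh

/-- Ties decided in the coordinate `y₁` (Tonelli over `x` first). [folklore] -/
theorem volume_tie_y {g h : (ℝ × ℝ) × (ℝ × (ℝ × ℝ)) → ℝ} (hg : Measurable g) (hh : Measurable h) :
    volume {c : ((ℝ × ℝ) × ((ℝ × ℝ) × (ℝ × ℝ))) |
      (c.2.1.1 - g (c.1, (c.2.1.2, c.2.2))) ^ 2 = h (c.1, (c.2.1.2, c.2.2))} = 0 := by
  have hS : MeasurableSet {c : ((ℝ × ℝ) × ((ℝ × ℝ) × (ℝ × ℝ))) |
      (c.2.1.1 - g (c.1, (c.2.1.2, c.2.2))) ^ 2 = h (c.1, (c.2.1.2, c.2.2))} :=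
    measurableSet_eq_fun (by fun_prop) (by fun_prop)
  have hsec : ∀ x : ℝ × ℝ, volume (Prod.mk x ⁻¹' {c : ((ℝ × ℝ) × ((ℝ × ℝ) × (ℝ × ℝ))) |
      (c.2.1.1 - g (c.1, (c.2.1.2, c.2.2))) ^ 2 = h (c.1, (c.2.1.2, c.2.2))}) = 0 := by
    intro x
    exact volume_quadSection_prod (R := ℝ × ℝ) (g := fun p => g (x, p)) (h := fun p => h (x, p))
      (by fun_prop) (by fun_prop)
  rw [Measure.volume_eq_prod, Measure.prod_apply hS]
  simp only [hsec, lintegral_zero]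

/-- Ties decided in the coordinate `z₁` (Tonelli over `x`, then `y`, first). [folklore] -/
theorem volume_tie_z {g h : (ℝ × ℝ) × ((ℝ × ℝ) × ℝ) → ℝ} (hg : Measurable g) (hh : Measurable h) :
    volume {c : ((ℝ × ℝ) × ((ℝ × ℝ) × (ℝ × ℝ))) |
      (c.2.2.1 - g (c.1, (c.2.1, c.2.2.2))) ^ 2 = h (c.1, (c.2.1, c.2.2.2))} = 0 := by
  have hS : MeasurableSet {c : ((ℝ × ℝ) × ((ℝ × ℝ) × (ℝ × ℝ))) |
      (c.2.2.1 - g (c.1, (c.2.1, c.2.2.2))) ^ 2 = h (c.1, (c.2.1, c.2.2.2))} :=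
    measurableSet_eq_fun (by fun_prop) (by fun_prop)
  have hsec : ∀ x : ℝ × ℝ, volume (Prod.mk x ⁻¹' {c : ((ℝ × ℝ) × ((ℝ × ℝ) × (ℝ × ℝ))) |
      (c.2.2.1 - g (c.1, (c.2.1, c.2.2.2))) ^ 2 = h (c.1, (c.2.1, c.2.2.2))}) = 0 := by
    intro x
    have hSx : MeasurableSet (Prod.mk x ⁻¹' {c : ((ℝ × ℝ) × ((ℝ × ℝ) × (ℝ × ℝ))) |
        (c.2.2.1 - g (c.1, (c.2.1, c.2.2.2))) ^ 2 = h (c.1, (c.2.1, c.2.2.2))}) :=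
      measurable_prodMk_left hS
    have hsec' : ∀ y : ℝ × ℝ, volume (Prod.mk y ⁻¹' (Prod.mk x ⁻¹'
        {c : ((ℝ × ℝ) × ((ℝ × ℝ) × (ℝ × ℝ))) |
        (c.2.2.1 - g (c.1, (c.2.1, c.2.2.2))) ^ 2 = h (c.1, (c.2.1, c.2.2.2))})) = 0 := by
      intro y
      exact volume_quadSection_fst (g := fun t => g (x, (y, t))) (h := fun t => h (x, (y, t)))
        (by fun_prop) (by fun_prop)
    rw [Measure.volume_eq_prod, Measure.prod_apply hSx]
    simp only [hsec', lintegral_zero]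
  rw [Measure.volume_eq_prod, Measure.prod_apply hS]
  simp only [hsec, lintegral_zero]

/-- The tie set (two of the six squared distances among `0, x, y, z` coincide) is Lebesgue-null:
each of the fifteen coincidences `d_i = d_j` is a monic quadratic equation in one of the
coordinates `x₁, y₁, z₁` given the others. [folklore] -/
theorem volume_ties : volume {c : ((ℝ × ℝ) × ((ℝ × ℝ) × (ℝ × ℝ))) |
      c.1.1 ^ (2:ℕ) + c.1.2 ^ (2:ℕ) = c.2.1.1 ^ (2:ℕ) + c.2.1.2 ^ (2:ℕ) ∨
      c.1.1 ^ (2:ℕ) + c.1.2 ^ (2:ℕ) = c.2.2.1 ^ (2:ℕ) + c.2.2.2 ^ (2:ℕ) ∨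
      c.1.1 ^ (2:ℕ) + c.1.2 ^ (2:ℕ) = (c.1.1 - c.2.1.1) ^ (2:ℕ) + (c.1.2 - c.2.1.2) ^ (2:ℕ) ∨
      c.1.1 ^ (2:ℕ) + c.1.2 ^ (2:ℕ) = (c.1.1 - c.2.2.1) ^ (2:ℕ) + (c.1.2 - c.2.2.2) ^ (2:ℕ) ∨
      c.1.1 ^ (2:ℕ) + c.1.2 ^ (2:ℕ) =
        (c.2.1.1 - c.2.2.1) ^ (2:ℕ) + (c.2.1.2 - c.2.2.2) ^ (2:ℕ) ∨
      c.2.1.1 ^ (2:ℕ) + c.2.1.2 ^ (2:ℕ) = c.2.2.1 ^ (2:ℕ) + c.2.2.2 ^ (2:ℕ) ∨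
      c.2.1.1 ^ (2:ℕ) + c.2.1.2 ^ (2:ℕ) =
        (c.1.1 - c.2.1.1) ^ (2:ℕ) + (c.1.2 - c.2.1.2) ^ (2:ℕ) ∨
      c.2.1.1 ^ (2:ℕ) + c.2.1.2 ^ (2:ℕ) =
        (c.1.1 - c.2.2.1) ^ (2:ℕ) + (c.1.2 - c.2.2.2) ^ (2:ℕ) ∨
      c.2.1.1 ^ (2:ℕ) + c.2.1.2 ^ (2:ℕ) =
        (c.2.1.1 - c.2.2.1) ^ (2:ℕ) + (c.2.1.2 - c.2.2.2) ^ (2:ℕ) ∨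
      c.2.2.1 ^ (2:ℕ) + c.2.2.2 ^ (2:ℕ) =
        (c.1.1 - c.2.1.1) ^ (2:ℕ) + (c.1.2 - c.2.1.2) ^ (2:ℕ) ∨
      c.2.2.1 ^ (2:ℕ) + c.2.2.2 ^ (2:ℕ) =
        (c.1.1 - c.2.2.1) ^ (2:ℕ) + (c.1.2 - c.2.2.2) ^ (2:ℕ) ∨
      c.2.2.1 ^ (2:ℕ) + c.2.2.2 ^ (2:ℕ) =
        (c.2.1.1 - c.2.2.1) ^ (2:ℕ) + (c.2.1.2 - c.2.2.2) ^ (2:ℕ) ∨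
      (c.1.1 - c.2.1.1) ^ (2:ℕ) + (c.1.2 - c.2.1.2) ^ (2:ℕ) =
        (c.1.1 - c.2.2.1) ^ (2:ℕ) + (c.1.2 - c.2.2.2) ^ (2:ℕ) ∨
      (c.1.1 - c.2.1.1) ^ (2:ℕ) + (c.1.2 - c.2.1.2) ^ (2:ℕ) =
        (c.2.1.1 - c.2.2.1) ^ (2:ℕ) + (c.2.1.2 - c.2.2.2) ^ (2:ℕ) ∨
      (c.1.1 - c.2.2.1) ^ (2:ℕ) + (c.1.2 - c.2.2.2) ^ (2:ℕ) =
        (c.2.1.1 - c.2.2.1) ^ (2:ℕ) + (c.2.1.2 - c.2.2.2) ^ (2:ℕ)} = 0 := by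
  simp only [setOf_or]
  refine measure_union_null ?_
    (measure_union_null ?_
    (measure_union_null ?_
    (measure_union_null ?_
    (measure_union_null ?_
    (measure_union_null ?_
    (measure_union_null ?_
    (measure_union_null ?_
    (measure_union_null ?_
    (measure_union_null ?_
    (measure_union_null ?_
    (measure_union_null ?_
    (measure_union_null ?_
    (measure_union_null ?_
    (?_))))))))))))))
  · -- `d1 = d2`, coordinate `x₁`
    refine measure_mono_null ?_ (volume_tie_x
      (g := fun p : ℝ × ((ℝ × ℝ) × (ℝ × ℝ)) => 0)
      (h := fun p : ℝ × ((ℝ × ℝ) × (ℝ × ℝ)) =>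
        p.2.1.1 ^ 2 + p.2.1.2 ^ 2 - p.1 ^ 2)
      (by fun_prop) (by fun_prop))
    intro c hc
    simp only [mem_setOf_eq] at hc ⊢
    linear_combination hc
  · -- `d1 = d3`, coordinate `x₁`
    refine measure_mono_null ?_ (volume_tie_x
      (g := fun p : ℝ × ((ℝ × ℝ) × (ℝ × ℝ)) => 0)
      (h := fun p : ℝ × ((ℝ × ℝ) × (ℝ × ℝ)) =>
        p.2.2.1 ^ 2 + p.2.2.2 ^ 2 - p.1 ^ 2)
      (by fun_prop) (by fun_prop))
    intro c hc
    simp only [mem_setOf_eq] at hc ⊢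
    linear_combination hc
  · -- `d1 = d4`, coordinate `y₁`
    refine measure_mono_null ?_ (volume_tie_y
      (g := fun p : (ℝ × ℝ) × (ℝ × (ℝ × ℝ)) => p.1.1)
      (h := fun p : (ℝ × ℝ) × (ℝ × (ℝ × ℝ)) =>
        p.1.1 ^ 2 + 2 * p.1.2 * p.2.1 - p.2.1 ^ 2)
      (by fun_prop) (by fun_prop))
    intro c hc
    simp only [mem_setOf_eq] at hc ⊢
    linear_combination -hc
  · -- `d1 = d5`, coordinate `z₁`
    refine measure_mono_null ?_ (volume_tie_z
      (g := fun p : (ℝ × ℝ) × ((ℝ × ℝ) × ℝ) => p.1.1)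
      (h := fun p : (ℝ × ℝ) × ((ℝ × ℝ) × ℝ) =>
        p.1.1 ^ 2 + 2 * p.1.2 * p.2.2 - p.2.2 ^ 2)
      (by fun_prop) (by fun_prop))
    intro c hc
    simp only [mem_setOf_eq] at hc ⊢
    linear_combination -hc
  · -- `d1 = d6`, coordinate `x₁`
    refine measure_mono_null ?_ (volume_tie_x
      (g := fun p : ℝ × ((ℝ × ℝ) × (ℝ × ℝ)) => 0)
      (h := fun p : ℝ × ((ℝ × ℝ) × (ℝ × ℝ)) =>
        (p.2.1.1 - p.2.2.1) ^ 2 + (p.2.1.2 - p.2.2.2) ^ 2 - p.1 ^ 2)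
      (by fun_prop) (by fun_prop))
    intro c hc
    simp only [mem_setOf_eq] at hc ⊢
    linear_combination hc
  · -- `d2 = d3`, coordinate `y₁`
    refine measure_mono_null ?_ (volume_tie_y
      (g := fun p : (ℝ × ℝ) × (ℝ × (ℝ × ℝ)) => 0)
      (h := fun p : (ℝ × ℝ) × (ℝ × (ℝ × ℝ)) =>
        p.2.2.1 ^ 2 + p.2.2.2 ^ 2 - p.2.1 ^ 2)
      (by fun_prop) (by fun_prop))
    intro c hc
    simp only [mem_setOf_eq] at hc ⊢
    linear_combination hc
  · -- `d2 = d4`, coordinate `x₁`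
    refine measure_mono_null ?_ (volume_tie_x
      (g := fun p : ℝ × ((ℝ × ℝ) × (ℝ × ℝ)) => p.2.1.1)
      (h := fun p : ℝ × ((ℝ × ℝ) × (ℝ × ℝ)) =>
        p.2.1.1 ^ 2 + p.2.1.2 ^ 2 - (p.1 - p.2.1.2) ^ 2)
      (by fun_prop) (by fun_prop))
    intro c hc
    simp only [mem_setOf_eq] at hc ⊢
    linear_combination -hc
  · -- `d2 = d5`, coordinate `y₁`
    refine measure_mono_null ?_ (volume_tie_y
      (g := fun p : (ℝ × ℝ) × (ℝ × (ℝ × ℝ)) => 0)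
      (h := fun p : (ℝ × ℝ) × (ℝ × (ℝ × ℝ)) =>
        (p.1.1 - p.2.2.1) ^ 2 + (p.1.2 - p.2.2.2) ^ 2 - p.2.1 ^ 2)
      (by fun_prop) (by fun_prop))
    intro c hc
    simp only [mem_setOf_eq] at hc ⊢
    linear_combination hc
  · -- `d2 = d6`, coordinate `z₁`
    refine measure_mono_null ?_ (volume_tie_z
      (g := fun p : (ℝ × ℝ) × ((ℝ × ℝ) × ℝ) => p.2.1.1)
      (h := fun p : (ℝ × ℝ) × ((ℝ × ℝ) × ℝ) =>
        p.2.1.1 ^ 2 + 2 * p.2.1.2 * p.2.2 - p.2.2 ^ 2)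
      (by fun_prop) (by fun_prop))
    intro c hc
    simp only [mem_setOf_eq] at hc ⊢
    linear_combination -hc
  · -- `d3 = d4`, coordinate `z₁`
    refine measure_mono_null ?_ (volume_tie_z
      (g := fun p : (ℝ × ℝ) × ((ℝ × ℝ) × ℝ) => 0)
      (h := fun p : (ℝ × ℝ) × ((ℝ × ℝ) × ℝ) =>
        (p.1.1 - p.2.1.1) ^ 2 + (p.1.2 - p.2.1.2) ^ 2 - p.2.2 ^ 2)
      (by fun_prop) (by fun_prop))
    intro c hc
    simp only [mem_setOf_eq] at hc ⊢
    linear_combination hc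
  · -- `d3 = d5`, coordinate `x₁`
    refine measure_mono_null ?_ (volume_tie_x
      (g := fun p : ℝ × ((ℝ × ℝ) × (ℝ × ℝ)) => p.2.2.1)
      (h := fun p : ℝ × ((ℝ × ℝ) × (ℝ × ℝ)) =>
        p.2.2.1 ^ 2 + p.2.2.2 ^ 2 - (p.1 - p.2.2.2) ^ 2)
      (by fun_prop) (by fun_prop))
    intro c hc
    simp only [mem_setOf_eq] at hc ⊢
    linear_combination -hc
  · -- `d3 = d6`, coordinate `y₁`
    refine measure_mono_null ?_ (volume_tie_y
      (g := fun p : (ℝ × ℝ) × (ℝ × (ℝ × ℝ)) => p.2.2.1)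
      (h := fun p : (ℝ × ℝ) × (ℝ × (ℝ × ℝ)) =>
        p.2.2.1 ^ 2 + p.2.2.2 ^ 2 - (p.2.1 - p.2.2.2) ^ 2)
      (by fun_prop) (by fun_prop))
    intro c hc
    simp only [mem_setOf_eq] at hc ⊢
    linear_combination -hc
  · -- `d4 = d5`, coordinate `y₁`
    refine measure_mono_null ?_ (volume_tie_y
      (g := fun p : (ℝ × ℝ) × (ℝ × (ℝ × ℝ)) => p.1.1)
      (h := fun p : (ℝ × ℝ) × (ℝ × (ℝ × ℝ)) =>
        (p.1.1 - p.2.2.1) ^ 2 + (p.1.2 - p.2.2.2) ^ 2 - (p.1.2 - p.2.1) ^ 2)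
      (by fun_prop) (by fun_prop))
    intro c hc
    simp only [mem_setOf_eq] at hc ⊢
    linear_combination hc
  · -- `d4 = d6`, coordinate `x₁`
    refine measure_mono_null ?_ (volume_tie_x
      (g := fun p : ℝ × ((ℝ × ℝ) × (ℝ × ℝ)) => p.2.1.1)
      (h := fun p : ℝ × ((ℝ × ℝ) × (ℝ × ℝ)) =>
        (p.2.1.1 - p.2.2.1) ^ 2 + (p.2.1.2 - p.2.2.2) ^ 2 - (p.1 - p.2.1.2) ^ 2)
      (by fun_prop) (by fun_prop))
    intro c hc
    simp only [mem_setOf_eq] at hc ⊢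
    linear_combination hc
  · -- `d5 = d6`, coordinate `x₁`
    refine measure_mono_null ?_ (volume_tie_x
      (g := fun p : ℝ × ((ℝ × ℝ) × (ℝ × ℝ)) => p.2.2.1)
      (h := fun p : ℝ × ((ℝ × ℝ) × (ℝ × ℝ)) =>
        (p.2.1.1 - p.2.2.1) ^ 2 + (p.2.1.2 - p.2.2.2) ^ 2 - (p.1 - p.2.2.2) ^ 2)
      (by fun_prop) (by fun_prop))
    intro c hc
    simp only [mem_setOf_eq] at hc ⊢
    linear_combination hc

/-! ### The star is the union of the six pieces up to ties -/

/-- Six pairwise distinct reals have a strict maximum. [folklore] -/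
theorem exists_strictMax_six (D1 D2 D3 D4 D5 D6 : ℝ) (n12 : D1 ≠ D2) (n13 : D1 ≠ D3)
    (n14 : D1 ≠ D4) (n15 : D1 ≠ D5) (n16 : D1 ≠ D6) (n23 : D2 ≠ D3) (n24 : D2 ≠ D4)
    (n25 : D2 ≠ D5) (n26 : D2 ≠ D6) (n34 : D3 ≠ D4) (n35 : D3 ≠ D5) (n36 : D3 ≠ D6)
    (n45 : D4 ≠ D5) (n46 : D4 ≠ D6) (n56 : D5 ≠ D6) :
    (D2 < D1 ∧ D3 < D1 ∧ D4 < D1 ∧ D5 < D1 ∧ D6 < D1) ∨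
    (D1 < D2 ∧ D3 < D2 ∧ D4 < D2 ∧ D5 < D2 ∧ D6 < D2) ∨
    (D1 < D3 ∧ D2 < D3 ∧ D4 < D3 ∧ D5 < D3 ∧ D6 < D3) ∨
    (D1 < D4 ∧ D2 < D4 ∧ D3 < D4 ∧ D5 < D4 ∧ D6 < D4) ∨
    (D1 < D5 ∧ D2 < D5 ∧ D3 < D5 ∧ D4 < D5 ∧ D6 < D5) ∨
    (D1 < D6 ∧ D2 < D6 ∧ D3 < D6 ∧ D4 < D6 ∧ D5 < D6) := by
  set m := max (max (max (max (max D1 D2) D3) D4) D5) D6 with hm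
  have l1 : D1 ≤ m :=
    le_trans (le_max_left _ _) (le_trans (le_max_left _ _)
      (le_trans (le_max_left _ _) (le_trans (le_max_left _ _) (le_max_left _ _))))
  have l2 : D2 ≤ m :=
    le_trans (le_max_right _ _) (le_trans (le_max_left _ _)
      (le_trans (le_max_left _ _) (le_trans (le_max_left _ _) (le_max_left _ _))))
  have l3 : D3 ≤ m :=
    le_trans (le_max_right _ _)
      (le_trans (le_max_left _ _) (le_trans (le_max_left _ _) (le_max_left _ _)))
  have l4 : D4 ≤ m := le_trans (le_max_right _ _) (le_trans (le_max_left _ _) (le_max_left _ _))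
  have l5 : D5 ≤ m := le_trans (le_max_right _ _) (le_max_left _ _)
  have l6 : D6 ≤ m := le_max_right _ _
  have hcases : m = D1 ∨ m = D2 ∨ m = D3 ∨ m = D4 ∨ m = D5 ∨ m = D6 := by
    rw [hm]
    rcases max_choice (max (max (max (max D1 D2) D3) D4) D5) D6 with e | e <;> rw [e]
    · rcases max_choice (max (max (max D1 D2) D3) D4) D5 with e | e <;> rw [e]
      · rcases max_choice (max (max D1 D2) D3) D4 with e | e <;> rw [e]
        · rcases max_choice (max D1 D2) D3 with e | e <;> rw [e]
          · rcases max_choice D1 D2 with e | e <;> rw [e]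
            · exact Or.inl rfl
            · exact Or.inr (Or.inl rfl)
          · exact Or.inr (Or.inr (Or.inl rfl))
        · exact Or.inr (Or.inr (Or.inr (Or.inl rfl)))
      · exact Or.inr (Or.inr (Or.inr (Or.inr (Or.inl rfl))))
    · exact Or.inr (Or.inr (Or.inr (Or.inr (Or.inr rfl))))
  rcases hcases with e | e | e | e | e | e <;> rw [e] at l1 l2 l3 l4 l5 l6
  · exact Or.inl ⟨lt_of_le_of_ne l2 (Ne.symm n12), lt_of_le_of_ne l3 (Ne.symm n13),
      lt_of_le_of_ne l4 (Ne.symm n14), lt_of_le_of_ne l5 (Ne.symm n15),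
      lt_of_le_of_ne l6 (Ne.symm n16)⟩
  · exact Or.inr (Or.inl ⟨lt_of_le_of_ne l1 n12, lt_of_le_of_ne l3 (Ne.symm n23),
      lt_of_le_of_ne l4 (Ne.symm n24), lt_of_le_of_ne l5 (Ne.symm n25),
      lt_of_le_of_ne l6 (Ne.symm n26)⟩)
  · exact Or.inr (Or.inr (Or.inl ⟨lt_of_le_of_ne l1 n13, lt_of_le_of_ne l2 n23,
      lt_of_le_of_ne l4 (Ne.symm n34), lt_of_le_of_ne l5 (Ne.symm n35),
      lt_of_le_of_ne l6 (Ne.symm n36)⟩))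
  · exact Or.inr (Or.inr (Or.inr (Or.inl ⟨lt_of_le_of_ne l1 n14, lt_of_le_of_ne l2 n24,
      lt_of_le_of_ne l3 n34, lt_of_le_of_ne l5 (Ne.symm n45), lt_of_le_of_ne l6 (Ne.symm n46)⟩)))
  · exact Or.inr (Or.inr (Or.inr (Or.inr (Or.inl ⟨lt_of_le_of_ne l1 n15, lt_of_le_of_ne l2 n25,
      lt_of_le_of_ne l3 n35, lt_of_le_of_ne l4 n45, lt_of_le_of_ne l6 (Ne.symm n56)⟩))))
  · exact Or.inr (Or.inr (Or.inr (Or.inr (Or.inr ⟨lt_of_le_of_ne l1 n16, lt_of_le_of_ne l2 n26,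
      lt_of_le_of_ne l3 n36, lt_of_le_of_ne l4 n46, lt_of_le_of_ne l5 n56⟩))))

/-- The volume of the union of the six pieces is `6 · vol(P₁)` (the pieces are pairwise disjoint and
have equal volume). [folklore] -/
theorem volume_union_eq :
    volume ({c : ((ℝ × ℝ) × ((ℝ × ℝ) × (ℝ × ℝ))) |
      c.1.1 ^ (2:ℕ) + c.1.2 ^ (2:ℕ) < 1 ∧
      c.2.1.1 ^ (2:ℕ) + c.2.1.2 ^ (2:ℕ) < c.1.1 ^ (2:ℕ) + c.1.2 ^ (2:ℕ) ∧
      c.2.2.1 ^ (2:ℕ) + c.2.2.2 ^ (2:ℕ) < c.1.1 ^ (2:ℕ) + c.1.2 ^ (2:ℕ) ∧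
      (c.1.1 - c.2.1.1) ^ (2:ℕ) + (c.1.2 - c.2.1.2) ^ (2:ℕ) < c.1.1 ^ (2:ℕ) + c.1.2 ^ (2:ℕ) ∧
      (c.1.1 - c.2.2.1) ^ (2:ℕ) + (c.1.2 - c.2.2.2) ^ (2:ℕ) < c.1.1 ^ (2:ℕ) + c.1.2 ^ (2:ℕ) ∧
      (c.2.1.1 - c.2.2.1) ^ (2:ℕ) + (c.2.1.2 - c.2.2.2) ^ (2:ℕ) <
        c.1.1 ^ (2:ℕ) + c.1.2 ^ (2:ℕ)} ∪
    {c : ((ℝ × ℝ) × ((ℝ × ℝ) × (ℝ × ℝ))) |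
      c.2.1.1 ^ (2:ℕ) + c.2.1.2 ^ (2:ℕ) < 1 ∧
      c.1.1 ^ (2:ℕ) + c.1.2 ^ (2:ℕ) < c.2.1.1 ^ (2:ℕ) + c.2.1.2 ^ (2:ℕ) ∧
      c.2.2.1 ^ (2:ℕ) + c.2.2.2 ^ (2:ℕ) < c.2.1.1 ^ (2:ℕ) + c.2.1.2 ^ (2:ℕ) ∧
      (c.1.1 - c.2.1.1) ^ (2:ℕ) + (c.1.2 - c.2.1.2) ^ (2:ℕ) <
        c.2.1.1 ^ (2:ℕ) + c.2.1.2 ^ (2:ℕ) ∧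
      (c.1.1 - c.2.2.1) ^ (2:ℕ) + (c.1.2 - c.2.2.2) ^ (2:ℕ) <
        c.2.1.1 ^ (2:ℕ) + c.2.1.2 ^ (2:ℕ) ∧
      (c.2.1.1 - c.2.2.1) ^ (2:ℕ) + (c.2.1.2 - c.2.2.2) ^ (2:ℕ) <
        c.2.1.1 ^ (2:ℕ) + c.2.1.2 ^ (2:ℕ)} ∪
    {c : ((ℝ × ℝ) × ((ℝ × ℝ) × (ℝ × ℝ))) |
      c.2.2.1 ^ (2:ℕ) + c.2.2.2 ^ (2:ℕ) < 1 ∧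
      c.1.1 ^ (2:ℕ) + c.1.2 ^ (2:ℕ) < c.2.2.1 ^ (2:ℕ) + c.2.2.2 ^ (2:ℕ) ∧
      c.2.1.1 ^ (2:ℕ) + c.2.1.2 ^ (2:ℕ) < c.2.2.1 ^ (2:ℕ) + c.2.2.2 ^ (2:ℕ) ∧
      (c.1.1 - c.2.1.1) ^ (2:ℕ) + (c.1.2 - c.2.1.2) ^ (2:ℕ) <
        c.2.2.1 ^ (2:ℕ) + c.2.2.2 ^ (2:ℕ) ∧
      (c.1.1 - c.2.2.1) ^ (2:ℕ) + (c.1.2 - c.2.2.2) ^ (2:ℕ) <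
        c.2.2.1 ^ (2:ℕ) + c.2.2.2 ^ (2:ℕ) ∧
      (c.2.1.1 - c.2.2.1) ^ (2:ℕ) + (c.2.1.2 - c.2.2.2) ^ (2:ℕ) <
        c.2.2.1 ^ (2:ℕ) + c.2.2.2 ^ (2:ℕ)} ∪
    {c : ((ℝ × ℝ) × ((ℝ × ℝ) × (ℝ × ℝ))) |
      (c.1.1 - c.2.1.1) ^ (2:ℕ) + (c.1.2 - c.2.1.2) ^ (2:ℕ) < 1 ∧
      c.1.1 ^ (2:ℕ) + c.1.2 ^ (2:ℕ) < (c.1.1 - c.2.1.1) ^ (2:ℕ) + (c.1.2 - c.2.1.2) ^ (2:ℕ) ∧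
      c.2.1.1 ^ (2:ℕ) + c.2.1.2 ^ (2:ℕ) <
        (c.1.1 - c.2.1.1) ^ (2:ℕ) + (c.1.2 - c.2.1.2) ^ (2:ℕ) ∧
      c.2.2.1 ^ (2:ℕ) + c.2.2.2 ^ (2:ℕ) <
        (c.1.1 - c.2.1.1) ^ (2:ℕ) + (c.1.2 - c.2.1.2) ^ (2:ℕ) ∧
      (c.1.1 - c.2.2.1) ^ (2:ℕ) + (c.1.2 - c.2.2.2) ^ (2:ℕ) <
        (c.1.1 - c.2.1.1) ^ (2:ℕ) + (c.1.2 - c.2.1.2) ^ (2:ℕ) ∧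
      (c.2.1.1 - c.2.2.1) ^ (2:ℕ) + (c.2.1.2 - c.2.2.2) ^ (2:ℕ) <
        (c.1.1 - c.2.1.1) ^ (2:ℕ) + (c.1.2 - c.2.1.2) ^ (2:ℕ)} ∪
    {c : ((ℝ × ℝ) × ((ℝ × ℝ) × (ℝ × ℝ))) |
      (c.1.1 - c.2.2.1) ^ (2:ℕ) + (c.1.2 - c.2.2.2) ^ (2:ℕ) < 1 ∧
      c.1.1 ^ (2:ℕ) + c.1.2 ^ (2:ℕ) < (c.1.1 - c.2.2.1) ^ (2:ℕ) + (c.1.2 - c.2.2.2) ^ (2:ℕ) ∧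
      c.2.1.1 ^ (2:ℕ) + c.2.1.2 ^ (2:ℕ) <
        (c.1.1 - c.2.2.1) ^ (2:ℕ) + (c.1.2 - c.2.2.2) ^ (2:ℕ) ∧
      c.2.2.1 ^ (2:ℕ) + c.2.2.2 ^ (2:ℕ) <
        (c.1.1 - c.2.2.1) ^ (2:ℕ) + (c.1.2 - c.2.2.2) ^ (2:ℕ) ∧
      (c.1.1 - c.2.1.1) ^ (2:ℕ) + (c.1.2 - c.2.1.2) ^ (2:ℕ) <
        (c.1.1 - c.2.2.1) ^ (2:ℕ) + (c.1.2 - c.2.2.2) ^ (2:ℕ) ∧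
      (c.2.1.1 - c.2.2.1) ^ (2:ℕ) + (c.2.1.2 - c.2.2.2) ^ (2:ℕ) <
        (c.1.1 - c.2.2.1) ^ (2:ℕ) + (c.1.2 - c.2.2.2) ^ (2:ℕ)} ∪
    {c : ((ℝ × ℝ) × ((ℝ × ℝ) × (ℝ × ℝ))) |
      (c.2.1.1 - c.2.2.1) ^ (2:ℕ) + (c.2.1.2 - c.2.2.2) ^ (2:ℕ) < 1 ∧
      c.1.1 ^ (2:ℕ) + c.1.2 ^ (2:ℕ) <
        (c.2.1.1 - c.2.2.1) ^ (2:ℕ) + (c.2.1.2 - c.2.2.2) ^ (2:ℕ) ∧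
      c.2.1.1 ^ (2:ℕ) + c.2.1.2 ^ (2:ℕ) <
        (c.2.1.1 - c.2.2.1) ^ (2:ℕ) + (c.2.1.2 - c.2.2.2) ^ (2:ℕ) ∧
      c.2.2.1 ^ (2:ℕ) + c.2.2.2 ^ (2:ℕ) <
        (c.2.1.1 - c.2.2.1) ^ (2:ℕ) + (c.2.1.2 - c.2.2.2) ^ (2:ℕ) ∧
      (c.1.1 - c.2.1.1) ^ (2:ℕ) + (c.1.2 - c.2.1.2) ^ (2:ℕ) <
        (c.2.1.1 - c.2.2.1) ^ (2:ℕ) + (c.2.1.2 - c.2.2.2) ^ (2:ℕ) ∧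
      (c.1.1 - c.2.2.1) ^ (2:ℕ) + (c.1.2 - c.2.2.2) ^ (2:ℕ) <
        (c.2.1.1 - c.2.2.1) ^ (2:ℕ) + (c.2.1.2 - c.2.2.2) ^ (2:ℕ)}) =
    6 * volume {c : ((ℝ × ℝ) × ((ℝ × ℝ) × (ℝ × ℝ))) |
      c.1.1 ^ (2:ℕ) + c.1.2 ^ (2:ℕ) < 1 ∧
      c.2.1.1 ^ (2:ℕ) + c.2.1.2 ^ (2:ℕ) < c.1.1 ^ (2:ℕ) + c.1.2 ^ (2:ℕ) ∧
      c.2.2.1 ^ (2:ℕ) + c.2.2.2 ^ (2:ℕ) < c.1.1 ^ (2:ℕ) + c.1.2 ^ (2:ℕ) ∧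
      (c.1.1 - c.2.1.1) ^ (2:ℕ) + (c.1.2 - c.2.1.2) ^ (2:ℕ) < c.1.1 ^ (2:ℕ) + c.1.2 ^ (2:ℕ) ∧
      (c.1.1 - c.2.2.1) ^ (2:ℕ) + (c.1.2 - c.2.2.2) ^ (2:ℕ) < c.1.1 ^ (2:ℕ) + c.1.2 ^ (2:ℕ) ∧
      (c.2.1.1 - c.2.2.1) ^ (2:ℕ) + (c.2.1.2 - c.2.2.2) ^ (2:ℕ) <
        c.1.1 ^ (2:ℕ) + c.1.2 ^ (2:ℕ)} := by
  rw [measure_union ?d6 measurableSet_P6, measure_union ?d5 measurableSet_P5,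
    measure_union ?d4 measurableSet_P4, measure_union ?d3 measurableSet_P3,
    measure_union ?d2 measurableSet_P2, volume_P2_P6.2, volume_P3_P5.2, volume_P4, volume_P3_P5.1,
    volume_P2_P6.1]
  · ring
  case d6 =>
    refine Set.disjoint_union_left.mpr
      ⟨Set.disjoint_union_left.mpr
      ⟨Set.disjoint_union_left.mpr
      ⟨Set.disjoint_union_left.mpr
      ⟨?_, ?_⟩, ?_⟩, ?_⟩, ?_⟩ <;>
      exact (Set.disjoint_left.mpr (fun c hs ht => by
        obtain ⟨a1, a2, a3, a4, a5, a6⟩ := hs; obtain ⟨b1, b2, b3, b4, b5, b6⟩ := ht; linarith))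
  case d5 =>
    refine Set.disjoint_union_left.mpr
      ⟨Set.disjoint_union_left.mpr
      ⟨Set.disjoint_union_left.mpr
      ⟨?_, ?_⟩, ?_⟩, ?_⟩ <;>
      exact (Set.disjoint_left.mpr (fun c hs ht => by
        obtain ⟨a1, a2, a3, a4, a5, a6⟩ := hs; obtain ⟨b1, b2, b3, b4, b5, b6⟩ := ht; linarith))
  case d4 =>
    refine Set.disjoint_union_left.mpr
      ⟨Set.disjoint_union_left.mpr
      ⟨?_, ?_⟩, ?_⟩ <;>
      exact (Set.disjoint_left.mpr (fun c hs ht => by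
        obtain ⟨a1, a2, a3, a4, a5, a6⟩ := hs; obtain ⟨b1, b2, b3, b4, b5, b6⟩ := ht; linarith))
  case d3 =>
    refine Set.disjoint_union_left.mpr
      ⟨?_, ?_⟩ <;>
      exact (Set.disjoint_left.mpr (fun c hs ht => by
        obtain ⟨a1, a2, a3, a4, a5, a6⟩ := hs; obtain ⟨b1, b2, b3, b4, b5, b6⟩ := ht; linarith))
  case d2 =>
    exact (Set.disjoint_left.mpr (fun c hs ht => by
        obtain ⟨a1, a2, a3, a4, a5, a6⟩ := hs; obtain ⟨b1, b2, b3, b4, b5, b6⟩ := ht; linarith))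

/-- **Symmetry reduction**: `vol(star) = 6 · vol(P₁)` — off the null tie set one squared distance
is the strict maximum, so the star is the union of the six (disjoint) pieces up to a null set.
[folklore] -/
theorem volume_star_eq :
    volume {c : ((ℝ × ℝ) × ((ℝ × ℝ) × (ℝ × ℝ))) |
      c.1.1 ^ (2:ℕ) + c.1.2 ^ (2:ℕ) < 1 ∧
      c.2.1.1 ^ (2:ℕ) + c.2.1.2 ^ (2:ℕ) < 1 ∧
      c.2.2.1 ^ (2:ℕ) + c.2.2.2 ^ (2:ℕ) < 1 ∧
      (c.1.1 - c.2.1.1) ^ (2:ℕ) + (c.1.2 - c.2.1.2) ^ (2:ℕ) < 1 ∧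
      (c.1.1 - c.2.2.1) ^ (2:ℕ) + (c.1.2 - c.2.2.2) ^ (2:ℕ) < 1 ∧
      (c.2.1.1 - c.2.2.1) ^ (2:ℕ) + (c.2.1.2 - c.2.2.2) ^ (2:ℕ) < 1} =
    6 * volume {c : ((ℝ × ℝ) × ((ℝ × ℝ) × (ℝ × ℝ))) |
      c.1.1 ^ (2:ℕ) + c.1.2 ^ (2:ℕ) < 1 ∧
      c.2.1.1 ^ (2:ℕ) + c.2.1.2 ^ (2:ℕ) < c.1.1 ^ (2:ℕ) + c.1.2 ^ (2:ℕ) ∧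
      c.2.2.1 ^ (2:ℕ) + c.2.2.2 ^ (2:ℕ) < c.1.1 ^ (2:ℕ) + c.1.2 ^ (2:ℕ) ∧
      (c.1.1 - c.2.1.1) ^ (2:ℕ) + (c.1.2 - c.2.1.2) ^ (2:ℕ) < c.1.1 ^ (2:ℕ) + c.1.2 ^ (2:ℕ) ∧
      (c.1.1 - c.2.2.1) ^ (2:ℕ) + (c.1.2 - c.2.2.2) ^ (2:ℕ) < c.1.1 ^ (2:ℕ) + c.1.2 ^ (2:ℕ) ∧
      (c.2.1.1 - c.2.2.1) ^ (2:ℕ) + (c.2.1.2 - c.2.2.2) ^ (2:ℕ) <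
        c.1.1 ^ (2:ℕ) + c.1.2 ^ (2:ℕ)} := by
  rw [← volume_union_eq]
  refine (measure_eq_measure_of_null_sdiff ?_ ?_).symm
  · -- the pieces lie in the star
    rintro c (((((⟨a1, a2, a3, a4, a5, a6⟩ | ⟨a1, a2, a3, a4, a5, a6⟩) | ⟨a1, a2, a3, a4, a5, a6⟩) |
      ⟨a1, a2, a3, a4, a5, a6⟩) | ⟨a1, a2, a3, a4, a5, a6⟩) | ⟨a1, a2, a3, a4, a5, a6⟩) <;>
      exact ⟨by linarith, by linarith, by linarith, by linarith, by linarith, by linarith⟩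
  · -- off the tie set, one distance is the strict maximum
    refine measure_mono_null (fun c hc => ?_) volume_ties
    by_contra hnt
    apply hc.2
    obtain ⟨h1, h2, h3, h4, h5, h6⟩ := hc.1
    simp only [mem_setOf_eq, not_or] at hnt
    obtain ⟨n12, n13, n14, n15, n16, n23, n24, n25, n26, n34, n35, n36, n45, n46, n56⟩ := hnt
    rcases exists_strictMax_six _ _ _ _ _ _ n12 n13 n14 n15 n16 n23 n24 n25 n26 n34 n35 n36 n45
      n46 n56 with ⟨a, b, c', d, e⟩ | ⟨a, b, c', d, e⟩ | ⟨a, b, c', d, e⟩ | ⟨a, b, c', d, e⟩ |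
      ⟨a, b, c', d, e⟩ | ⟨a, b, c', d, e⟩
    · exact Or.inl (Or.inl (Or.inl (Or.inl (Or.inl ⟨h1, a, b, c', d, e⟩))))
    · exact Or.inl (Or.inl (Or.inl (Or.inl (Or.inr ⟨h2, a, b, c', d, e⟩))))
    · exact Or.inl (Or.inl (Or.inl (Or.inr ⟨h3, a, b, c', d, e⟩)))
    · exact Or.inl (Or.inl (Or.inr ⟨h4, a, b, c', d, e⟩))
    · exact Or.inl (Or.inr ⟨h5, a, b, c', d, e⟩)
    · exact Or.inr ⟨h6, a, b, c', d, e⟩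

end HardDiscStarVolume

end Literature.MathematicalPhysics.StatisticalMechanics

end
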